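import Literature.Computability.AlgebraicComplexity.KronRectDesignCertificates
import HarnessLib

/-!
# Design certificates for `k_m(δ) > 0`, LETTER-MAJOR: the `m!` quotient and a two-stage verified evaluator

P. Bürgisser, C. Ikenmeyer, *Fundamental invariants of orbit closures*, J. Algebra **477** (2017)
[BurgisserIkenmeyer2017], §5, Thm. 5.9 (2) / Thm. 5.13 (the invariants `P_t` of triples of wedge
lists = "obstruction designs"; at the unit tensor a signed count of Latin colourings, Prop. 5.22);
A. Amanov, D. Yeliussizov, IMRN 2023 = arXiv:2202.11059 [AmanovYeliussizov2022], §7–§8 (Def. 7.4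
partial Latin cubes / `AT₃(k,T)`, Thm. 8.4 (ii): for EVEN `k` all labellings of one resolution into
diagonals carry the same sign, Cor. 8.5: `AT₃(k,T) ≠ 0 ⇒ g₃(n,k) > 0`).

THEOREM-ONLY companion of the tree's engine `AC/KronRectDesignCertificates.lean` (val-lit t03 g7:
bridge `kronRect_pos_of_sum_blockSignTriple_diag_ne_zero`, integer signs `DesignEnum.tripleZ`, and a
CELL-major enumerator `DesignEnum.enum`). For three block structures
`e₁ e₂ e₃ : Fin (m·δ) ≃ Fin δ × Fin m` this file adds:

* §1 `latinSum` (the signed count of Latin colourings in `ℤ`) and the bridge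
  `kronRect_pos_of_latinSum_ne_zero` (cast of the engine's bridge);
* §2 **the `m!` quotient, publicly** (AY22 Thm. 8.4 (ii)): `tripleZ (σ ∘ u) = tripleZ u` for an even
  number of blocks, `latinSum = m! · normSum` (`normSum` = the colourings reading `0,…,m-1` along
  block `0` of `e₁`), `kronRect_pos_of_normSum_ne_zero`;
* §3 a generic **verified depth-first list** `dfsList` of the words admissible under a prefix test
  (`mem_dfsList_iff`, `nodup_dfsList`);
* §4 the **LETTER-MAJOR evaluator**: stage 1 `diagList a` = the DIAGONALS of the design through the
  start `pos 0 a` (one position in every block of `e₁`, pairwise distinct `e₂`- and `e₃`-blocks —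
  the letter class of `a` in any Latin colouring), as bit masks (`mem_diagList_iff`); stage 2
  `coverSum` = the signed exact-cover sum (each letter, in a given service order, takes a diagonal
  through its start disjoint from the occupied positions; a complete cover contributes the triple
  block sign of its colouring `wordOf`); **`lmEval_eq_normSum`**: the evaluator computes `normSum`
  for every service order (the letter class of each letter of a normalised Latin colouring is exactly
  one listed diagonal, `sum_diagList_indicator`; dead branches vanish, `partialSum_cons_eq_zero`;
  a complete disjoint family pins the colouring down, `partialSum_leaf`);
* §5 the certificate interface `kronRect_pos_of_lmEval_ne_zero` /
  `kronRect_pos_of_coverSum_ne_zero` (stage-1 lists may be supplied as literal tables checked by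
  `List.Perm`), and a kernel smoke test on the cube `[2]³` (`k_4(2)`: value `1`).

Why letter-major: on RIGID designs (unique resolution into diagonals, AY22 §8 / val-lit t04 g7's
(11,6) magic set) the cell-major search does not terminate in `6·10⁷` nodes while the exact-cover
tree over precomputed diagonals has `10⁴–5·10⁴` nodes; consumer `AC/KronRectElevenSix.lean`
(`kronRect_eleven_six_pos`, hypothesis `h11_6` of `BI2017_ex_5_6_of_atoms`).

Honest framing: a verified evaluator for a published certificate type (BI 2013/2017 obstruction
designs, AY 2022 Latin-cube signs); literature bookkeeping for the cell `val-lit`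
(LADDER-VALIANT V3); nothing here bears on VP versus VNP.

## References
* [BurgisserIkenmeyer2017] Thm. 5.9 (proof of (2)), Thm. 5.13 (proof), Def. 5.21, Prop. 5.22.
* [AmanovYeliussizov2022] Def. 7.4, Lemma 8.2, Thm. 8.4, Cor. 8.5.

## Mathlib and tree
Tree: `wordBlockSign`, `blockSignTriple`, `kronRect`, `kronRect_pos_of_sum_blockSignTriple_diag_ne_zero`,
`DesignEnum.seqSignZ`, `DesignEnum.wordBlockSignZ`, `DesignEnum.tripleZ` (`KronRectDesignCertificates`),
`Kumar2015.seqSign`, `Kumar2015.seqSign_coe_perm`, `Kumar2015.seqSign_eq_prod_ite`.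
Mathlib: `Equiv.Perm.sign`, `Fintype.sum_equiv`, `Finset.sum_comm`, `Nat.testBit_lor`,
`Nat.testBit_land`, `Nat.testBit_two_pow`, `Nat.eq_of_testBit_eq`, `List.nodup_flatMap`,
`Finite.injective_iff_surjective`.

Provenance: val-lit cell, prover val-lit-p4 g7 (programme #8b, arbiter ruling #5, 2026-08-27).
-/

open _root_.Literature.NumberTheory.DiophantineGeometry

namespace Literature.Computability.AlgebraicComplexity

namespace DesignLM

variable {D b N : ℕ}

/-! ### §1 The signed count of Latin colourings of a design and the bridge to `k_m(δ)` -/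

/-- The computable sequence sign of the engine file agrees with `Kumar2015.seqSign` (the tree's
private `seqSignZ_eq`, re-proved; plumbing). [folklore] -/
private theorem seqSignZ_eq_coe (g : Fin N → Fin N) :
    DesignEnum.seqSignZ g = ((Kumar2015.seqSign g : ℤˣ) : ℤ) := by
  rw [Kumar2015.seqSign_eq_prod_ite, DesignEnum.seqSignZ]
  push_cast
  refine Finset.prod_congr rfl fun p _ => Finset.prod_congr rfl fun p' _ => ?_
  split_ifs <;> simp

/-- The engine's integer block sign `DesignEnum.wordBlockSignZ`, in `seqSign` form (plumbing). [folklore] -/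
private theorem wordBlockSignZ_eq (e : Fin D ≃ Fin b × Fin N) (u : Word N D) :
    DesignEnum.wordBlockSignZ e u =
      if ∀ a, Function.Bijective (fun j => u (e.symm (a, j))) then
        ∏ a, ((Kumar2015.seqSign (fun j => u (e.symm (a, j))) : ℤˣ) : ℤ) else 0 := by
  unfold DesignEnum.wordBlockSignZ
  split_ifs with h
  · exact Finset.prod_congr rfl fun a _ => seqSignZ_eq_coe _
  · rfl

/-- **The signed count of Latin colourings** of the design `(e₁, e₂, e₃)`: `∑_u ζ_{e₁}(u) ζ_{e₂}(u) ζ_{e₃}(u)`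
over all words `u : [D] → [N]` in `ℤ` (the engine's `DesignEnum.tripleZ` summed; a word contributes
`0` unless it is a bijection on every block of every `e_ℓ`) — BI's `P_t(⟨N⟩)`, AY22's
`∑_C sgn₁(C)sgn₂(C)sgn₃(C)`. [cite: BurgisserIkenmeyer2017, Prop. 5.22 (1)] -/
def latinSum (e₁ e₂ e₃ : Fin D ≃ Fin b × Fin N) : ℤ :=
  ∑ u : Word N D, DesignEnum.tripleZ e₁ e₂ e₃ u

/-- The block sign over a field is the cast of the engine's integer block sign (the engine file's
private `cast_wordBlockSignZ`, re-proved; plumbing). [folklore] -/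
private theorem wordBlockSign_eq_cast (k : Type*) [Field k] (e : Fin D ≃ Fin b × Fin N) (u : Word N D) :
    wordBlockSign k e u = ((DesignEnum.wordBlockSignZ e u : ℤ) : k) := by
  rw [wordBlockSignZ_eq]
  unfold wordBlockSign
  split_ifs with h
  · push_cast; rfl
  · push_cast; rfl

/-- The diagonal of `P_t` over a field is the cast of the integer triple sign (plumbing). [folklore] -/
private theorem blockSignTriple_diag_eq_cast (k : Type*) [Field k] (e₁ e₂ e₃ : Fin D ≃ Fin b × Fin N)
    (u : Word N D) :
    blockSignTriple k e₁ e₂ e₃ ((u, u), u) = ((DesignEnum.tripleZ e₁ e₂ e₃ u : ℤ) : k) := by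
  simp only [blockSignTriple, DesignEnum.tripleZ, wordBlockSign_eq_cast k, Int.cast_mul]

/-- **Design certificate ⇒ positivity, integer form: `latinSum e₁ e₂ e₃ ≠ 0 ⇒ 0 < k_m(δ)`** for three
block structures `e_ℓ : [m·δ] ≃ [δ] × [m]` — the engine file's
`kronRect_pos_of_sum_blockSignTriple_diag_ne_zero` read in `ℤ`.
[cite: BurgisserIkenmeyer2017, Thm. 5.9 (2) and Thm. 5.13 (proof)] -/
theorem kronRect_pos_of_latinSum_ne_zero (k : Type*) [Field k] [CharZero k] {m δ : ℕ}
    (e₁ e₂ e₃ : Fin (m * δ) ≃ Fin δ × Fin m) (h : latinSum e₁ e₂ e₃ ≠ 0) :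
    0 < kronRect k m δ := by
  refine kronRect_pos_of_sum_blockSignTriple_diag_ne_zero k e₁ e₂ e₃ ?_
  simp_rw [blockSignTriple_diag_eq_cast k]
  rw [← Int.cast_sum, Int.cast_ne_zero]
  exact h

/-! ### §2 The `m!` quotient: relabelling the letters (AY22 Thm. 8.4 (ii)) -/

/-- A bijection test is invariant under post-composition with a permutation (plumbing). [folklore] -/
private theorem bijective_perm_comp_iff (σ : Equiv.Perm (Fin N)) (g : Fin N → Fin N) :
    Function.Bijective (⇑σ ∘ g) ↔ Function.Bijective g :=
  ⟨fun h => by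
    have : g = ⇑σ.symm ∘ (⇑σ ∘ g) := by funext j; simp
    rw [this]; exact σ.symm.bijective.comp h,
   fun h => σ.bijective.comp h⟩

/-- **Relabelling the letters multiplies a block sign by `sgn(σ)^b`** (`b` = number of blocks): each
bijective block word `g` becomes `σ ∘ g`, of sign `sgn(σ)·sgn(g)`.
[cite: AmanovYeliussizov2022, Thm. 8.4 (proof of (ii))] -/
theorem wordBlockSignZ_perm_comp (e : Fin D ≃ Fin b × Fin N) (σ : Equiv.Perm (Fin N)) (u : Word N D) :
    DesignEnum.wordBlockSignZ e (⇑σ ∘ u) =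
      ((Equiv.Perm.sign σ : ℤˣ) : ℤ) ^ b * DesignEnum.wordBlockSignZ e u := by
  rw [wordBlockSignZ_eq, wordBlockSignZ_eq]
  have hiff : (∀ a, Function.Bijective fun j => (⇑σ ∘ u) (e.symm (a, j))) ↔
      ∀ a, Function.Bijective fun j => u (e.symm (a, j)) :=
    forall_congr' fun a => bijective_perm_comp_iff σ (fun j => u (e.symm (a, j)))
  by_cases h : ∀ a, Function.Bijective fun j => u (e.symm (a, j))
  · rw [if_pos (hiff.2 h), if_pos h]
    have hblock : ∀ a, ((Kumar2015.seqSign (fun j => (⇑σ ∘ u) (e.symm (a, j))) : ℤˣ) : ℤ) =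
        ((Equiv.Perm.sign σ : ℤˣ) : ℤ) * ((Kumar2015.seqSign (fun j => u (e.symm (a, j))) : ℤˣ) : ℤ) := by
      intro a
      set τ : Equiv.Perm (Fin N) := Equiv.ofBijective _ (h a) with hτ
      have hg : (fun j => u (e.symm (a, j))) = ⇑τ := by rw [hτ, Equiv.coe_ofBijective]
      have hσg : (fun j => (⇑σ ∘ u) (e.symm (a, j))) = ⇑(τ.trans σ) := by
        funext j; simp only [Function.comp_apply, Equiv.coe_trans, hτ, Equiv.ofBijective_apply]
      rw [hσg, hg, Kumar2015.seqSign_coe_perm, Kumar2015.seqSign_coe_perm, ← Units.val_mul,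
        ← map_mul]
      congr 2
    simp_rw [hblock]
    rw [Finset.prod_mul_distrib, Finset.prod_const, Finset.card_univ, Fintype.card_fin]
  · rw [if_neg (fun h' => h (hiff.1 h')), if_neg h, mul_zero]

/-- A sign raised to an even power is `1` (plumbing). [folklore] -/
private theorem units_sign_pow_even (s : ℤˣ) {n : ℕ} (hn : Even n) : ((s : ℤ)) ^ n = 1 := by
  obtain ⟨t, rfl⟩ := hn
  rw [← two_mul, pow_mul]
  rcases Int.units_eq_one_or s with hs | hs <;> simp [hs]

/-- **For an even number of blocks the triple block sign is invariant under relabelling the letters**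
(`sgn(σ)^{3b} = 1`; AY22: "each (u v) swap … in total changes the sign `d·k` times, hence the sign does
not change if `k` is even"). [cite: AmanovYeliussizov2022, Thm. 8.4 (proof of (ii))] -/
theorem tripleZ_perm_comp (e₁ e₂ e₃ : Fin D ≃ Fin b × Fin N) (hb : Even b)
    (σ : Equiv.Perm (Fin N)) (u : Word N D) :
    DesignEnum.tripleZ e₁ e₂ e₃ (⇑σ ∘ u) = DesignEnum.tripleZ e₁ e₂ e₃ u := by
  simp only [DesignEnum.tripleZ, wordBlockSignZ_perm_comp, units_sign_pow_even _ hb, one_mul]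

section Quotient

variable [NeZero b]

/-- A word is **normalised** (along block `0` of `e₁`) if it reads `0, 1, …, N-1` there — one
representative per `𝔖_N`-orbit of Latin colourings ("fix the symbols of the first slice").
[cite: AmanovYeliussizov2022, Thm. 8.4 (proof of (ii))] -/
def IsNormalised (e₁ : Fin D ≃ Fin b × Fin N) (u : Word N D) : Prop :=
  ∀ j : Fin N, u (e₁.symm (0, j)) = j

/-- Normalisation is decidable (plumbing). [folklore] -/
private instance (e₁ : Fin D ≃ Fin b × Fin N) (u : Word N D) : Decidable (IsNormalised e₁ u) := by
  unfold IsNormalised; infer_instance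

/-- **The normalised signed count**: the triple block signs summed over the normalised words only.
[cite: AmanovYeliussizov2022, Thm. 8.4 (ii)] -/
def normSum (e₁ e₂ e₃ : Fin D ≃ Fin b × Fin N) : ℤ :=
  ∑ u : Word N D, if IsNormalised e₁ u then DesignEnum.tripleZ e₁ e₂ e₃ u else 0

/-- The triple sign vanishes unless block `0` of `e₁` is read bijectively (plumbing). [folklore] -/
private theorem tripleZ_eq_zero_of_not_bijective (e₁ e₂ e₃ : Fin D ≃ Fin b × Fin N) (u : Word N D)
    (h : ¬ Function.Bijective fun j => u (e₁.symm (0, j))) : DesignEnum.tripleZ e₁ e₂ e₃ u = 0 := by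
  have h1 : DesignEnum.wordBlockSignZ e₁ u = 0 := by
    rw [wordBlockSignZ_eq, if_neg (fun hall => h (hall 0))]
  simp [DesignEnum.tripleZ, h1]

/-- **`latinSum = N! · normSum` for an even number of blocks** (AY22 Thm. 8.4 (ii): "`ω^n = ± n! ∑_T
AT₃(k,T) ψ_T`" — the `n!` labellings of one resolution all carry the same sign when `k` is even):
every word that is bijective on block `0` of `e₁` is uniquely `σ ∘ v` with `v` normalised, and the
triple sign is `σ`-invariant. [cite: AmanovYeliussizov2022, Thm. 8.4 (ii)] -/
theorem latinSum_eq_factorial_mul_normSum (e₁ e₂ e₃ : Fin D ≃ Fin b × Fin N) (hb : Even b) :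
    latinSum e₁ e₂ e₃ = (Nat.factorial N : ℤ) * normSum e₁ e₂ e₃ := by
  classical
  -- insert the indicator of `σ = u|_{block 0}`
  have step1 : ∀ u : Word N D, DesignEnum.tripleZ e₁ e₂ e₃ u =
      ∑ σ : Equiv.Perm (Fin N), if (fun j => u (e₁.symm (0, j))) = ⇑σ then
        DesignEnum.tripleZ e₁ e₂ e₃ u else 0 := by
    intro u
    by_cases h : Function.Bijective fun j => u (e₁.symm (0, j))
    · have heq : ∀ σ : Equiv.Perm (Fin N), ((fun j => u (e₁.symm (0, j))) = ⇑σ) ↔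
          σ = Equiv.ofBijective _ h := by
        intro σ
        constructor
        · intro hσ; ext j; rw [Equiv.ofBijective_apply, ← hσ]
        · intro hσ; rw [hσ, Equiv.coe_ofBijective]
      simp_rw [heq]
      rw [Finset.sum_ite_eq' Finset.univ (Equiv.ofBijective _ h), if_pos (Finset.mem_univ _)]
    · rw [tripleZ_eq_zero_of_not_bijective e₁ e₂ e₃ u h]
      symm
      refine Finset.sum_eq_zero fun σ _ => ?_
      rw [if_neg]
      intro hσ
      exact h (hσ ▸ σ.bijective)
  unfold latinSum
  rw [Finset.sum_congr rfl fun u _ => step1 u, Finset.sum_comm]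
  -- reindex `u = σ ∘ v` inside each `σ`-summand
  have step2 : ∀ σ : Equiv.Perm (Fin N),
      (∑ u : Word N D, if (fun j => u (e₁.symm (0, j))) = ⇑σ then
          DesignEnum.tripleZ e₁ e₂ e₃ u else 0) =
        normSum e₁ e₂ e₃ := by
    intro σ
    unfold normSum
    refine Fintype.sum_equiv (Equiv.arrowCongr (Equiv.refl (Fin D)) σ).symm _ _ fun u => ?_
    -- `(arrowCongr refl σ).symm u = σ.symm ∘ u`
    have hu : ((Equiv.arrowCongr (Equiv.refl (Fin D)) σ).symm u) = ⇑σ.symm ∘ u := by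
      funext p; simp [Equiv.arrowCongr]
    rw [hu, tripleZ_perm_comp e₁ e₂ e₃ hb]
    have hiff : ((fun j => u (e₁.symm (0, j))) = ⇑σ) ↔ IsNormalised e₁ (⇑σ.symm ∘ u) := by
      unfold IsNormalised
      constructor
      · intro h j
        have hj : u (e₁.symm (0, j)) = σ j := congrFun h j
        simp only [Function.comp_apply, hj, Equiv.symm_apply_apply]
      · intro h
        funext j
        have hj := h j
        simp only [Function.comp_apply] at hj
        calc u (e₁.symm (0, j)) = σ (σ.symm (u (e₁.symm (0, j)))) := (Equiv.apply_symm_apply σ _).symm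
          _ = σ j := by rw [hj]
    by_cases hc : (fun j => u (e₁.symm (0, j))) = ⇑σ
    · rw [if_pos hc, if_pos (hiff.1 hc)]
    · rw [if_neg hc, if_neg (fun h' => hc (hiff.2 h'))]
  simp_rw [step2]
  rw [Finset.sum_const, Finset.card_univ, Fintype.card_perm, Fintype.card_fin, nsmul_eq_mul]

omit [NeZero b] in
/-- **Design certificate, quotient form**: for an even number `δ` of blocks, `normSum ≠ 0 ⇒ 0 < k_m(δ)`.
[cite: AmanovYeliussizov2022, Cor. 8.5] -/
theorem kronRect_pos_of_normSum_ne_zero (k : Type*) [Field k] [CharZero k] {m δ : ℕ} [NeZero δ]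
    (hδ : Even δ) (e₁ e₂ e₃ : Fin (m * δ) ≃ Fin δ × Fin m) (h : normSum e₁ e₂ e₃ ≠ 0) :
    0 < kronRect k m δ := by
  refine kronRect_pos_of_latinSum_ne_zero k e₁ e₂ e₃ ?_
  rw [latinSum_eq_factorial_mul_normSum e₁ e₂ e₃ hδ]
  exact mul_ne_zero (Int.natCast_ne_zero.2 (Nat.factorial_ne_zero _)) h

end Quotient

/-! ### §3 A generic verified depth-first list of admissible words -/

section DFSList

variable {α : Type*}

/-- A word `r` (newest letter first) is **admissible for `n` steps** if each of its `n` newest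
prefixes `r.drop t`, `t < n`, passes the test `P`. [folklore] -/
private def AllPrefixes (P : List α → Bool) (n : ℕ) (r : List α) : Prop :=
  ∀ t < n, P (r.drop t) = true

/-- Admissibility is decidable (plumbing). [folklore] -/
private instance (P : List α → Bool) (n : ℕ) (r : List α) : Decidable (AllPrefixes P n r) := by
  unfold AllPrefixes; infer_instance

/-- Admissibility for `n + 1` steps of `x :: w` = the newest test and admissibility of `w`
(plumbing). [folklore] -/
private theorem allPrefixes_cons (P : List α → Bool) (n : ℕ) (x : α) (w : List α) :
    AllPrefixes P (n + 1) (x :: w) ↔ P (x :: w) = true ∧ AllPrefixes P n w := by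
  constructor
  · intro h
    exact ⟨h 0 (Nat.succ_pos n), fun t ht => h (t + 1) (by omega)⟩
  · rintro ⟨h0, h⟩ t ht
    rcases t with _ | t
    · exact h0
    · exact h t (by omega)

/-- **Depth-first list**: all `n`-fold extensions of `w` (newest letter first, by `cons`) each of
whose `n` newest prefixes passes `P`; failing prefixes are pruned at once. [folklore] -/
def dfsList (alphabet : List α) (P : List α → Bool) : ℕ → List α → List (List α)
  | 0, w => [w]
  | n + 1, w => alphabet.flatMap fun x => if P (x :: w) then dfsList alphabet P n (x :: w) else []

/-- **Soundness and completeness of the depth-first list** (for an alphabet listing every letter):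
`r` is listed iff it extends `w` by `n` letters and is admissible for `n` steps. [folklore] -/
private theorem mem_dfsList_iff (alphabet : List α) (hα : ∀ x, x ∈ alphabet) (P : List α → Bool) :
    ∀ (n : ℕ) (w r : List α), r ∈ dfsList alphabet P n w ↔
      r.length = w.length + n ∧ r.drop n = w ∧ AllPrefixes P n r := by
  intro n
  induction n with
  | zero =>
    intro w r
    simp only [dfsList, List.mem_singleton, List.drop_zero, Nat.add_zero]
    constructor
    · rintro rfl; exact ⟨rfl, rfl, fun t ht => absurd ht (Nat.not_lt_zero t)⟩
    · rintro ⟨-, h, -⟩; exact h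
  | succ n ih =>
    intro w r
    simp only [dfsList, List.mem_flatMap]
    constructor
    · rintro ⟨x, -, hx⟩
      by_cases hP : P (x :: w) = true
      · rw [if_pos hP, ih] at hx
        obtain ⟨hlen, hdrop, hall⟩ := hx
        refine ⟨by rw [hlen, List.length_cons]; omega, by rw [← List.tail_drop, hdrop]; rfl, ?_⟩
        intro t ht
        rcases Nat.lt_succ_iff_lt_or_eq.1 ht with ht' | rfl
        · exact hall t ht'
        · rw [hdrop]; exact hP
      · rw [if_neg hP] at hx; exact absurd hx List.not_mem_nil
    · rintro ⟨hlen, hdrop, hall⟩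
      have hne : r.drop n ≠ [] := by
        intro h
        have := List.drop_eq_nil_iff.1 h
        omega
      obtain ⟨x, l, hl⟩ := List.exists_cons_of_ne_nil hne
      have hlw : l = w := by
        have : (r.drop n).tail = w := by rw [List.tail_drop, hdrop]
        rw [hl] at this; exact this
      subst hlw
      refine ⟨x, hα x, ?_⟩
      have hP : P (x :: l) = true := by rw [← hl]; exact hall n (Nat.lt_succ_self n)
      rw [if_pos hP, ih]
      exact ⟨by rw [List.length_cons]; omega, hl, fun t ht => hall t (by omega)⟩

/-- Every listed word extends the base word (plumbing). [folklore] -/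
private theorem drop_of_mem_dfsList (alphabet : List α) (P : List α → Bool) :
    ∀ (n : ℕ) (w r : List α), r ∈ dfsList alphabet P n w → r.drop n = w := by
  intro n
  induction n with
  | zero => intro w r hr; rw [dfsList, List.mem_singleton] at hr; rw [hr]; rfl
  | succ n ih =>
    intro w r hr
    rw [dfsList, List.mem_flatMap] at hr
    obtain ⟨x, -, hx⟩ := hr
    by_cases hP : P (x :: w) = true
    · rw [if_pos hP] at hx
      rw [← List.tail_drop, ih _ _ hx]
      rfl
    · rw [if_neg hP] at hx; exact absurd hx List.not_mem_nil

/-- The depth-first list has no duplicates (for an alphabet without duplicates). [folklore] -/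
private theorem nodup_dfsList (alphabet : List α) (hα : alphabet.Nodup) (P : List α → Bool) :
    ∀ (n : ℕ) (w : List α), (dfsList alphabet P n w).Nodup := by
  intro n
  induction n with
  | zero => intro w; exact List.nodup_singleton w
  | succ n ih =>
    intro w
    rw [dfsList, List.nodup_flatMap]
    refine ⟨fun x _ => ?_, ?_⟩
    · split_ifs
      · exact ih _
      · exact List.nodup_nil
    · refine List.Nodup.pairwise_of_forall_ne hα fun x _ y _ hxy => ?_
      intro r hr hr'
      have key : ∀ z, r ∈ (if P (z :: w) = true then dfsList alphabet P n (z :: w) else []) →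
          r.drop n = z :: w := by
        intro z hz
        by_cases hz' : P (z :: w) = true
        · rw [if_pos hz'] at hz; exact drop_of_mem_dfsList alphabet P n _ _ hz
        · rw [if_neg hz'] at hz; exact absurd hz List.not_mem_nil
      have h1 := key x hr
      have h2 := key y hr'
      rw [h1] at h2
      exact hxy (List.cons.inj h2).1

end DFSList

/-! ### §4 The letter-major evaluator: diagonals through a start (stage 1), signed exact covers (stage 2) -/

section LetterMajor

variable (e₁ e₂ e₃ : Fin D ≃ Fin b × Fin N) [NeZero b]

/-- Position `j` of block `i` of `e₁`. [folklore] -/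
abbrev pos (i : Fin b) (j : Fin N) : Fin D := e₁.symm (i, j)

/-- The bit mask of a list of positions (`∨` of `2^p`). [folklore] -/
def maskOf : List (Fin D) → ℕ
  | [] => 0
  | q :: l => 2 ^ q.val ||| maskOf l

/-- The positions of a partial diagonal: the choice word `w = [x_{i}, …, x_1]` (newest first) puts
letter's position `pos (r+1) x_{r+1}` in block `r + 1` (block index clamped into `Fin b`). [folklore] -/
def dpos : List (Fin N) → List (Fin D)
  | [] => []
  | x :: w => pos e₁ (Fin.ofNat b (w.length + 1)) x :: dpos w

/-- **Stage-1 admissibility**: the new position (block `|w|+1`, index `x`) of the partial diagonal of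
letter `a` must avoid the `e₂`- and `e₃`-blocks of the start `pos 0 a` and of the positions chosen so
far. [cite: AmanovYeliussizov2022, Def. 7.4] -/
def diagAdm (a : Fin N) (w : List (Fin N)) (x : Fin N) : Bool :=
  let p := pos e₁ (Fin.ofNat b (w.length + 1)) x
  (dpos e₁ w ++ [pos e₁ 0 a]).all fun q =>
    decide ((e₂ q).1 ≠ (e₂ p).1) && decide ((e₃ q).1 ≠ (e₃ p).1)

/-- The stage-1 prefix test in the shape expected by `dfsList`. [folklore] -/
def diagP (a : Fin N) : List (Fin N) → Bool
  | [] => true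
  | x :: w => diagAdm e₁ e₂ e₃ a w x

/-- **The diagonals of the design through the start `pos 0 a`**, as bit masks: one position in
every block of `e₁`, pairwise distinct `e₂`-blocks and `e₃`-blocks (a "diagonal" of the magic
set / a letter class of a Latin colouring). [cite: AmanovYeliussizov2022, Def. 7.4] -/
def diagList (a : Fin N) : List ℕ :=
  (dfsList (List.finRange N) (diagP e₁ e₂ e₃ a) (b - 1) []).map fun w => maskOf (dpos e₁ w ++ [pos e₁ 0 a])

/-- The word of a complete cover: block `0` of `e₁` normalised, every other position carries the
letter whose chosen diagonal contains it. [folklore] -/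
def wordOf (chosen : List (Fin N × ℕ)) : Word N D := fun p =>
  if (e₁ p).1 = 0 then (e₁ p).2 else
    match chosen.find? (fun ad => ad.2.testBit p.val) with
    | some ad => ad.1
    | none => (e₁ p).2

/-- **Stage 2, the signed exact-cover sum**: letters are served in the order `ord`; letter `a` takes
each diagonal through its start that is disjoint from the positions already occupied; a complete
cover contributes the triple block sign of its colouring. [cite: AmanovYeliussizov2022, Thm. 8.4 (ii)] -/
def coverSum (dl : Fin N → List ℕ) : List (Fin N) → ℕ → List (Fin N × ℕ) → ℤ
  | [], _, chosen => DesignEnum.tripleZ e₁ e₂ e₃ (wordOf e₁ chosen)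
  | a :: rest, occ, chosen =>
    ((dl a).map fun d =>
      if occ &&& d = 0 then coverSum dl rest (occ ||| d) ((a, d) :: chosen) else 0).sum

/-- **The letter-major evaluator** of the design `(e₁, e₂, e₃)` with letter order `ord`. [folklore] -/
def lmEval (ord : List (Fin N)) : ℤ :=
  coverSum e₁ e₂ e₃ (diagList e₁ e₂ e₃) ord 0 []

end LetterMajor

/-! #### Soundness, stage 1: `diagList a` lists exactly the diagonals through `pos 0 a`, once each -/

section Sound

variable (e₁ e₂ e₃ : Fin D ≃ Fin b × Fin N)

/-- Bits of a mask (plumbing). [folklore] -/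
private theorem testBit_maskOf (l : List (Fin D)) (n : ℕ) :
    (maskOf l).testBit n = true ↔ ∃ q ∈ l, q.val = n := by
  induction l with
  | nil => simp [maskOf]
  | cons q l ih =>
    rw [maskOf, Nat.testBit_lor, Bool.or_eq_true, ih, Nat.testBit_two_pow, decide_eq_true_eq]
    constructor
    · rintro (h | ⟨q', hq', h⟩)
      · exact ⟨q, List.mem_cons_self, h⟩
      · exact ⟨q', List.mem_cons_of_mem _ hq', h⟩
    · rintro ⟨q', hq', h⟩
      rcases List.mem_cons.1 hq' with rfl | hq'
      · exact Or.inl h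
      · exact Or.inr ⟨q', hq', h⟩

/-- A mask bit at a position: membership (plumbing). [folklore] -/
private theorem testBit_maskOf_val (l : List (Fin D)) (p : Fin D) :
    (maskOf l).testBit p.val = true ↔ p ∈ l := by
  rw [testBit_maskOf]
  constructor
  · rintro ⟨q, hq, h⟩; rwa [← Fin.ext h]
  · intro h; exact ⟨p, h, rfl⟩

/-- Two masks are disjoint iff no bit is common (plumbing). [folklore] -/
private theorem land_eq_zero_iff (x y : ℕ) : x &&& y = 0 ↔ ∀ n, ¬ (x.testBit n = true ∧ y.testBit n = true) := by
  constructor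
  · intro h n ⟨hx, hy⟩
    have := congrArg (fun z => Nat.testBit z n) h
    simp only [Nat.testBit_land, hx, hy, Bool.and_self, Nat.zero_testBit] at this
    exact Bool.noConfusion this
  · intro h
    apply Nat.eq_of_testBit_eq
    intro n
    rw [Nat.testBit_land, Nat.zero_testBit, Bool.and_eq_false_iff]
    by_cases hx : x.testBit n = true
    · right; simpa using fun hy => h n ⟨hx, hy⟩
    · left; simpa using hx

variable [NeZero b]

/-- Length of the position list of a partial diagonal (plumbing). [folklore] -/
private theorem length_dpos (w : List (Fin N)) : (dpos e₁ w).length = w.length := by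
  induction w with
  | nil => rfl
  | cons x w ih => simp only [dpos, List.length_cons, ih]

/-- The clamped block index is the true one below `b` (plumbing). [folklore] -/
private theorem fin_ofNat_eq {r : ℕ} (h : r < b) : (Fin.ofNat b r : Fin b) = ⟨r, h⟩ := by
  ext; simp [Nat.mod_eq_of_lt h]

/-- Membership in the position list of a partial diagonal: the entry for block `i`,
`1 ≤ i ≤ |w|`, counted from the END of `w` (plumbing). [folklore] -/
private theorem mem_dpos_iff (w : List (Fin N)) (q : Fin D) :
    q ∈ dpos e₁ w ↔ ∃ (i : ℕ) (hi : i < w.length),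
      q = pos e₁ (Fin.ofNat b (i + 1)) (w.reverse.get ⟨i, by rwa [List.length_reverse]⟩) := by
  induction w with
  | nil => simp [dpos]
  | cons x w ih =>
    rw [dpos, List.mem_cons, ih]
    constructor
    · rintro (rfl | ⟨i, hi, rfl⟩)
      · refine ⟨w.length, by simp, ?_⟩
        congr 1
        simp [List.getElem_append_right]
      · refine ⟨i, by simp; omega, ?_⟩
        congr 1
        simp [List.getElem_append_left, hi]
    · rintro ⟨i, hi, rfl⟩
      rw [List.length_cons] at hi
      rcases Nat.lt_succ_iff_lt_or_eq.1 hi with hi' | rfl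
      · right
        refine ⟨i, hi', ?_⟩
        congr 1
        simp [List.getElem_append_left, hi']
      · left
        congr 1
        simp [List.getElem_append_right]

/-- The block of a position of a partial diagonal (plumbing). [folklore] -/
private theorem block_of_mem_dpos {w : List (Fin N)} (hw : w.length < b) {q : Fin D} (hq : q ∈ dpos e₁ w) :
    1 ≤ (e₁ q).1.val ∧ (e₁ q).1.val ≤ w.length := by
  obtain ⟨i, hi, rfl⟩ := (mem_dpos_iff e₁ w q).1 hq
  rw [pos, Equiv.apply_symm_apply, fin_ofNat_eq (by omega)]
  simp only
  omega

/-- In each block `i`, `1 ≤ i ≤ |w|`, the partial diagonal has the position indexed by the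
corresponding entry of `w`, and no other (plumbing). [folklore] -/
private theorem mem_dpos_block_iff {w : List (Fin N)} (hw : w.length < b) {i : ℕ} (hi1 : 1 ≤ i)
    (hi : i ≤ w.length) (j : Fin N) :
    pos e₁ ⟨i, by omega⟩ j ∈ dpos e₁ w ↔
      j = w.reverse.get ⟨i - 1, by rw [List.length_reverse]; omega⟩ := by
  rw [mem_dpos_iff]
  constructor
  · rintro ⟨i', hi', h⟩
    have h' := congrArg e₁ h
    rw [pos, pos, Equiv.apply_symm_apply, Equiv.apply_symm_apply, fin_ofNat_eq (by omega)] at h'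
    obtain ⟨h1, h2⟩ := Prod.mk.inj h'
    have : i' = i - 1 := by
      have := congrArg Fin.val h1; simp at this; omega
    subst this
    exact h2
  · intro h
    subst h
    refine ⟨i - 1, by omega, ?_⟩
    rw [fin_ofNat_eq (by omega)]
    congr 2
    omega

/-- The block-disjointness relation of two positions: different `e₂`-blocks and different
`e₃`-blocks ("partial Latin cube" condition on two cells of one symbol class).
[cite: AmanovYeliussizov2022, Def. 7.4] -/
def BlockApart (q q' : Fin D) : Prop := (e₂ q).1 ≠ (e₂ q').1 ∧ (e₃ q).1 ≠ (e₃ q').1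

/-- The stage-1 test spelled out (plumbing). [folklore] -/
private theorem diagAdm_eq_true_iff (a : Fin N) (w : List (Fin N)) (x : Fin N) :
    diagAdm e₁ e₂ e₃ a w x = true ↔
      ∀ q ∈ dpos e₁ w ++ [pos e₁ 0 a], BlockApart e₂ e₃ q (pos e₁ (Fin.ofNat b (w.length + 1)) x) := by
  unfold diagAdm BlockApart
  simp only [List.all_eq_true, Bool.and_eq_true, decide_eq_true_eq]

/-- **Admissibility of a stage-1 word = pairwise block-disjointness of its positions** (the start
`pos 0 a` included). [cite: AmanovYeliussizov2022, Def. 7.4] -/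
private theorem allPrefixes_diagP_iff (a : Fin N) :
    ∀ w : List (Fin N), AllPrefixes (diagP e₁ e₂ e₃ a) w.length w ↔
      (dpos e₁ w ++ [pos e₁ 0 a]).Pairwise (BlockApart e₂ e₃) := by
  intro w
  induction w with
  | nil =>
    simp only [List.length_nil, dpos, List.nil_append, List.pairwise_singleton, iff_true]
    intro t ht; exact absurd ht (Nat.not_lt_zero t)
  | cons x w ih =>
    rw [List.length_cons, allPrefixes_cons, ih, dpos, List.cons_append, List.pairwise_cons]
    have hP : diagP e₁ e₂ e₃ a (x :: w) = diagAdm e₁ e₂ e₃ a w x := rfl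
    rw [hP, diagAdm_eq_true_iff]
    constructor
    · rintro ⟨h1, h2⟩
      exact ⟨fun q hq => let h := h1 q hq; ⟨h.1.symm, h.2.symm⟩, h2⟩
    · rintro ⟨h1, h2⟩
      exact ⟨fun q hq => let h := h1 q hq; ⟨h.1.symm, h.2.symm⟩, h2⟩

/-- **What `diagList a` lists**: the masks of the position lists `dpos w ++ [pos 0 a]` of the
admissible words `w` of length `b - 1`. [cite: AmanovYeliussizov2022, Def. 7.4] -/
theorem mem_diagList_iff (a : Fin N) (d : ℕ) :
    d ∈ diagList e₁ e₂ e₃ a ↔ ∃ w : List (Fin N), w.length = b - 1 ∧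
      (dpos e₁ w ++ [pos e₁ 0 a]).Pairwise (BlockApart e₂ e₃) ∧ d = maskOf (dpos e₁ w ++ [pos e₁ 0 a]) := by
  unfold diagList
  rw [List.mem_map]
  constructor
  · rintro ⟨w, hw, rfl⟩
    rw [mem_dfsList_iff _ List.mem_finRange] at hw
    obtain ⟨hlen, -, hall⟩ := hw
    rw [List.length_nil, Nat.zero_add] at hlen
    refine ⟨w, hlen, ?_, rfl⟩
    rw [← allPrefixes_diagP_iff, hlen]; exact hall
  · rintro ⟨w, hlen, hpw, rfl⟩
    refine ⟨w, ?_, rfl⟩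
    rw [mem_dfsList_iff _ List.mem_finRange]
    refine ⟨by rw [hlen, List.length_nil, Nat.zero_add], List.drop_eq_nil_iff.2 (by omega), ?_⟩
    rw [← hlen, allPrefixes_diagP_iff]; exact hpw


/-! #### Soundness, stage 2: the letter classes of a Latin colouring and the signed exact covers -/

omit [NeZero b] in
/-- The triple block sign vanishes unless the word is bijective on every block of each of the three
structures (plumbing). [folklore] -/
private theorem bijective_of_tripleZ_ne_zero {u : Word N D} (h : DesignEnum.tripleZ e₁ e₂ e₃ u ≠ 0) :
    (∀ i, Function.Bijective fun j => u (e₁.symm (i, j))) ∧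
      (∀ i, Function.Bijective fun j => u (e₂.symm (i, j))) ∧
      (∀ i, Function.Bijective fun j => u (e₃.symm (i, j))) := by
  unfold DesignEnum.tripleZ at h
  rw [wordBlockSignZ_eq, wordBlockSignZ_eq, wordBlockSignZ_eq] at h
  refine ⟨?_, ?_, ?_⟩
  · by_contra hc; rw [if_neg hc] at h; simp at h
  · by_contra hc; rw [if_neg hc] at h; simp at h
  · by_contra hc; rw [if_neg hc] at h; simp at h

omit [NeZero b] in
/-- Injectivity on the blocks of `e`: two positions in one block with the same letter coincide
(plumbing). [folklore] -/
private theorem eq_of_block_eq (e : Fin D ≃ Fin b × Fin N) {u : Word N D}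
    (h : ∀ i, Function.Bijective fun j => u (e.symm (i, j))) {q q' : Fin D}
    (hb : (e q).1 = (e q').1) (hu : u q = u q') : q = q' := by
  have hq : q = e.symm ((e q).1, (e q).2) := by simp
  have hq' : q' = e.symm ((e q).1, (e q').2) := by rw [hb]; simp
  rw [hq, hq'] at hu
  have := (h (e q).1).1 hu
  rw [hq, hq', this]

/-- **The letter class of a Latin colouring, as a stage-1 word**: in block `i ≥ 1` of `e₁` the
index of the unique position carrying `a` (newest = highest block first). [folklore] -/
private noncomputable def wOf (u : Word N D) (h : ∀ i, Function.Bijective fun j => u (e₁.symm (i, j)))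
    (a : Fin N) : ℕ → List (Fin N)
  | 0 => []
  | n + 1 => (Equiv.ofBijective _ (h (Fin.ofNat b (n + 1)))).symm a :: wOf u h a n

/-- Length of the letter-class word (plumbing). [folklore] -/
private theorem length_wOf (u : Word N D) (h : ∀ i, Function.Bijective fun j => u (e₁.symm (i, j)))
    (a : Fin N) : ∀ n, (wOf e₁ u h a n).length = n
  | 0 => rfl
  | n + 1 => by simp only [wOf, List.length_cons, length_wOf u h a n]

/-- Every position of the letter class carries the letter (plumbing). [folklore] -/
private theorem apply_eq_of_mem_dpos_wOf (u : Word N D) (h : ∀ i, Function.Bijective fun j => u (e₁.symm (i, j)))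
    (a : Fin N) : ∀ n, ∀ q ∈ dpos e₁ (wOf e₁ u h a n), u q = a
  | 0 => by simp [wOf, dpos]
  | n + 1 => by
    intro q hq
    rw [wOf, dpos, List.mem_cons, length_wOf] at hq
    rcases hq with rfl | hq
    · exact Equiv.ofBijective_apply_symm_apply _ (h _) a
    · exact apply_eq_of_mem_dpos_wOf u h a n q hq

/-- **Uniqueness of the letter class**: two stage-1 words of the same length all of whose positions
carry the letter `a` coincide (injectivity of `u` on the blocks of `e₁`). [folklore] -/
private theorem dpos_words_eq (u : Word N D) (h : ∀ i, Function.Bijective fun j => u (e₁.symm (i, j)))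
    (a : Fin N) : ∀ (w w' : List (Fin N)), w.length = w'.length →
      (∀ q ∈ dpos e₁ w, u q = a) → (∀ q ∈ dpos e₁ w', u q = a) → w = w'
  | [], [], _, _, _ => rfl
  | [], _ :: _, hl, _, _ => by simp at hl
  | _ :: _, [], hl, _, _ => by simp at hl
  | x :: w, x' :: w', hl, hw, hw' => by
    rw [List.length_cons, List.length_cons, Nat.succ_inj] at hl
    have hx : u (pos e₁ (Fin.ofNat b (w.length + 1)) x) = a := hw _ (by simp [dpos])
    have hx' : u (pos e₁ (Fin.ofNat b (w.length + 1)) x') = a := by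
      rw [hl]; exact hw' _ (by simp [dpos])
    have hxx : x = x' := (h _).1 (hx.trans hx'.symm)
    rw [hxx, dpos_words_eq u h a w w' hl (fun q hq => hw q (by simp [dpos, hq]))
      (fun q hq => hw' q (by simp [dpos, hq]))]

/-- The blocks along `dpos w ++ [pos 0 a]` strictly decrease (plumbing). [folklore] -/
private theorem pairwise_block_gt (a : Fin N) : ∀ (w : List (Fin N)), w.length < b →
    (dpos e₁ w ++ [pos e₁ 0 a]).Pairwise (fun q q' => (e₁ q').1.val < (e₁ q).1.val)
  | [], _ => by simp [dpos]
  | x :: w, hw => by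
    rw [List.length_cons] at hw
    rw [dpos, List.cons_append, List.pairwise_cons]
    refine ⟨fun q hq => ?_, pairwise_block_gt a w (by omega)⟩
    have hhead : (e₁ (pos e₁ (Fin.ofNat b (w.length + 1)) x)).1.val = w.length + 1 := by
      rw [pos, Equiv.apply_symm_apply, fin_ofNat_eq (by omega)]
    rw [hhead]
    rcases List.mem_append.1 hq with hq | hq
    · exact Nat.lt_succ_of_le (block_of_mem_dpos e₁ (by omega) hq).2
    · rw [List.mem_singleton] at hq
      rw [hq, pos, Equiv.apply_symm_apply]
      exact Nat.succ_pos _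

/-- The position list `dpos w ++ [pos 0 a]` has no duplicates (plumbing). [folklore] -/
private theorem nodup_dpos_append (a : Fin N) (w : List (Fin N)) (hw : w.length < b) :
    (dpos e₁ w ++ [pos e₁ 0 a]).Nodup :=
  (pairwise_block_gt e₁ a w hw).imp fun h heq => by rw [heq] at h; exact lt_irrefl _ h

/-- A test `Sub`: every position of the mask carries the letter `a`. [folklore] -/
private def Sub (a : Fin N) (d : ℕ) (u : Word N D) : Prop := ∀ p : Fin D, d.testBit p.val = true → u p = a

omit [NeZero b] in
/-- `Sub` is decidable (plumbing). [folklore] -/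
private instance (a : Fin N) (d : ℕ) (u : Word N D) : Decidable (Sub (D := D) a d u) := by
  unfold Sub; infer_instance

/-- **Exactly one diagonal of `diagList a` is the letter class of `a`** in a colouring that is
bijective on the blocks of `e₁` and injective on those of `e₂`, `e₃`, with `u (pos 0 a) = a`: the
indicator of `Sub a · u` sums to one over `diagList a`. [cite: AmanovYeliussizov2022, Def. 7.4] -/
private theorem sum_diagList_indicator (u : Word N D)
    (h₁ : ∀ i, Function.Bijective fun j => u (e₁.symm (i, j)))
    (h₂ : ∀ i, Function.Bijective fun j => u (e₂.symm (i, j)))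
    (h₃ : ∀ i, Function.Bijective fun j => u (e₃.symm (i, j)))
    (a : Fin N) (ha : u (pos e₁ 0 a) = a) (hb : 1 ≤ b) (c : ℤ) :
    ((diagList e₁ e₂ e₃ a).map fun d => if Sub a d u then c else 0).sum = c := by
  classical
  unfold diagList
  rw [List.map_map]
  set L := dfsList (List.finRange N) (diagP e₁ e₂ e₃ a) (b - 1) [] with hL
  set w₀ := wOf e₁ u h₁ a (b - 1) with hw₀
  -- the letter class is listed
  have hall : ∀ q ∈ dpos e₁ w₀ ++ [pos e₁ 0 a], u q = a := by
    intro q hq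
    rcases List.mem_append.1 hq with hq | hq
    · exact apply_eq_of_mem_dpos_wOf e₁ u h₁ a _ q hq
    · rw [List.mem_singleton] at hq; rw [hq]; exact ha
  have hmem : w₀ ∈ L := by
    rw [hL, mem_dfsList_iff _ List.mem_finRange]
    refine ⟨by rw [hw₀, length_wOf, List.length_nil, Nat.zero_add],
      List.drop_eq_nil_iff.2 (by rw [hw₀, length_wOf]), ?_⟩
    have hlen : (b - 1) = w₀.length := by rw [hw₀, length_wOf]
    rw [hlen, allPrefixes_diagP_iff]
    refine (nodup_dpos_append e₁ a w₀ (by rw [hw₀, length_wOf]; omega)).imp_of_mem ?_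
    intro q q' hq hq' hne
    refine ⟨fun heq => hne (eq_of_block_eq e₂ h₂ heq ?_), fun heq => hne (eq_of_block_eq e₃ h₃ heq ?_)⟩
    · rw [hall q hq, hall q' hq']
    · rw [hall q hq, hall q' hq']
  -- and it is the only listed word whose positions all carry `a`
  have huniq : ∀ w ∈ L, Sub a (maskOf (dpos e₁ w ++ [pos e₁ 0 a])) u → w = w₀ := by
    intro w hw hsub
    rw [hL, mem_dfsList_iff _ List.mem_finRange] at hw
    have hlen : w.length = b - 1 := by rw [hw.1, List.length_nil, Nat.zero_add]
    refine dpos_words_eq e₁ u h₁ a w w₀ (by rw [hlen, hw₀, length_wOf]) (fun q hq => ?_)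
      (fun q hq => hall q (List.mem_append_left _ hq))
    exact hsub q ((testBit_maskOf_val _ q).2 (List.mem_append_left _ hq))
  have hsub₀ : Sub a (maskOf (dpos e₁ w₀ ++ [pos e₁ 0 a])) u := fun q hq =>
    hall q ((testBit_maskOf_val _ q).1 hq)
  -- a nodup list with exactly one good element
  have hnd : L.Nodup := hL ▸ nodup_dfsList _ (List.nodup_finRange N) _ _ _
  rw [← List.sum_toFinset _ hnd]
  rw [Finset.sum_congr rfl (g := fun w => if w = w₀ then c else 0) fun w hw => ?_]
  · rw [Finset.sum_ite_eq', if_pos (List.mem_toFinset.2 hmem)]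
  · simp only [Function.comp_apply]
    by_cases hw₀ : w = w₀
    · rw [if_pos hw₀, if_pos (hw₀ ▸ hsub₀)]
    · rw [if_neg hw₀, if_neg (fun hs => hw₀ (huniq w (List.mem_toFinset.1 hw) hs))]


/-- **Consistency with the chosen diagonals**: every position of a chosen mask carries its letter.
[folklore] -/
private def Cons (chosen : List (Fin N × ℕ)) (u : Word N D) : Prop :=
  ∀ ad ∈ chosen, Sub (D := D) ad.1 ad.2 u

omit [NeZero b] in
/-- `Cons` is decidable (plumbing). [folklore] -/
private instance (chosen : List (Fin N × ℕ)) (u : Word N D) : Decidable (Cons (D := D) chosen u) := by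
  unfold Cons; infer_instance

/-- **The partial sum** of a stage-2 node: the triple block signs of the normalised words consistent
with the diagonals chosen so far. [folklore] -/
private def partialSum (chosen : List (Fin N × ℕ)) : ℤ :=
  ∑ u : Word N D, if IsNormalised e₁ u ∧ Cons chosen u then DesignEnum.tripleZ e₁ e₂ e₃ u else 0

/-- At the root the partial sum is the normalised sum (plumbing). [folklore] -/
private theorem partialSum_nil : partialSum e₁ e₂ e₃ [] = normSum e₁ e₂ e₃ := by
  unfold partialSum normSum
  refine Finset.sum_congr rfl fun u _ => ?_
  have : Cons (D := D) ([] : List (Fin N × ℕ)) u := fun ad h => absurd h List.not_mem_nil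
  simp only [this, and_true]

omit [NeZero b] in
/-- Interchanging a list sum with a finite sum (plumbing). [folklore] -/
private theorem list_sum_map_sum {β : Type*} (L : List β) (g : β → Word N D → ℤ) :
    (L.map fun d => ∑ u : Word N D, g d u).sum = ∑ u : Word N D, (L.map fun d => g d u).sum := by
  induction L with
  | nil => simp
  | cons d L ih => rw [List.map_cons, List.sum_cons, ih, ← Finset.sum_add_distrib]; rfl

/-- **Splitting step**: serving letter `a`, the partial sum splits over the diagonals of `diagList a`
(the letter class of `a` in each contributing colouring is exactly one of them).
[cite: AmanovYeliussizov2022, Thm. 8.4 (proof of (ii))] -/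
private theorem partialSum_split (hb : 1 ≤ b) (chosen : List (Fin N × ℕ)) (a : Fin N) :
    partialSum e₁ e₂ e₃ chosen =
      ((diagList e₁ e₂ e₃ a).map fun d => partialSum e₁ e₂ e₃ ((a, d) :: chosen)).sum := by
  unfold partialSum
  rw [list_sum_map_sum]
  refine Finset.sum_congr rfl fun u _ => ?_
  by_cases hT : DesignEnum.tripleZ e₁ e₂ e₃ u = 0
  · rw [hT]
    simp
  obtain ⟨h₁, h₂, h₃⟩ := bijective_of_tripleZ_ne_zero e₁ e₂ e₃ hT
  by_cases hnc : IsNormalised e₁ u ∧ Cons chosen u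
  · rw [if_pos hnc]
    have hcons : ∀ d, (IsNormalised e₁ u ∧ Cons ((a, d) :: chosen) u) ↔ Sub a d u := by
      intro d
      simp only [Cons, List.mem_cons, forall_eq_or_imp]
      exact ⟨fun h => h.2.1, fun h => ⟨hnc.1, h, hnc.2⟩⟩
    simp only [hcons]
    exact (sum_diagList_indicator e₁ e₂ e₃ u h₁ h₂ h₃ a (hnc.1 a) hb _).symm
  · rw [if_neg hnc]
    symm
    refine List.sum_eq_zero fun x hx => ?_
    rw [List.mem_map] at hx
    obtain ⟨d, -, rfl⟩ := hx
    rw [if_neg]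
    rintro ⟨hn, hc⟩
    exact hnc ⟨hn, fun ad had => hc ad (List.mem_cons_of_mem _ had)⟩

/-- **Pruning step**: a diagonal meeting a position already occupied by another letter contributes
nothing. [folklore] -/
private theorem partialSum_cons_eq_zero (chosen : List (Fin N × ℕ)) (a : Fin N) (d : ℕ)
    (ha : a ∉ chosen.map Prod.fst) (hd : d ∈ diagList e₁ e₂ e₃ a)
    {n : ℕ} (hdn : d.testBit n = true) (hocc : ∃ ad ∈ chosen, ad.2.testBit n = true) :
    partialSum e₁ e₂ e₃ ((a, d) :: chosen) = 0 := by
  unfold partialSum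
  refine Finset.sum_eq_zero fun u _ => ?_
  rw [if_neg]
  rintro ⟨-, hc⟩
  obtain ⟨w, -, -, rfl⟩ := (mem_diagList_iff e₁ e₂ e₃ a d).1 hd
  obtain ⟨q, -, hq⟩ := (testBit_maskOf _ n).1 hdn
  obtain ⟨ad, had, hadn⟩ := hocc
  have h1 : u q = a := hc (a, _) List.mem_cons_self q (hq ▸ hdn)
  have h2 : u q = ad.1 := hc ad (List.mem_cons_of_mem _ had) q (hq ▸ hadn)
  exact ha (List.mem_map.2 ⟨ad, had, by rw [← h2, h1]⟩)

/-- The only block-`0` position of a listed diagonal is its start (plumbing). [folklore] -/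
private theorem eq_start_of_testBit (a : Fin N) {d : ℕ} (hd : d ∈ diagList e₁ e₂ e₃ a) (hb : 1 ≤ b)
    {p : Fin D} (hp : d.testBit p.val = true) (h0 : (e₁ p).1 = 0) : p = pos e₁ 0 a := by
  obtain ⟨w, hlen, -, rfl⟩ := (mem_diagList_iff e₁ e₂ e₃ a d).1 hd
  rcases List.mem_append.1 ((testBit_maskOf_val _ p).1 hp) with hq | hq
  · have := (block_of_mem_dpos e₁ (by omega) hq).1
    rw [h0] at this
    exact absurd this (by simp)
  · exact List.mem_singleton.1 hq

/-- A listed diagonal has a position in every block `1 ≤ i < b` of `e₁`, indexed by an entry of its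
word (plumbing). [folklore] -/
private theorem testBit_pos_of_mem_diagList (a : Fin N) {d : ℕ} (hd : d ∈ diagList e₁ e₂ e₃ a)
    (i : Fin b) (hi : i ≠ 0) :
    ∃ j : Fin N, d.testBit (pos e₁ i j).val = true := by
  obtain ⟨w, hlen, -, rfl⟩ := (mem_diagList_iff e₁ e₂ e₃ a d).1 hd
  have hi1 : 1 ≤ i.val := Nat.one_le_iff_ne_zero.2 fun h => hi (Fin.ext h)
  have hiw : i.val ≤ w.length := by rw [hlen]; omega
  refine ⟨w.reverse.get ⟨i.val - 1, by rw [List.length_reverse]; omega⟩, ?_⟩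
  rw [testBit_maskOf_val]
  refine List.mem_append_left _ ?_
  have := (mem_dpos_block_iff e₁ (w := w) (by omega) hi1 hiw
    (w.reverse.get ⟨i.val - 1, by rw [List.length_reverse]; omega⟩)).2 rfl
  exact this

omit [NeZero b] in
/-- Two distinct members of a pairwise-disjoint list of masks are disjoint (plumbing). [folklore] -/
private theorem land_eq_zero_of_mem {chosen : List (Fin N × ℕ)}
    (hdisj : chosen.Pairwise fun x y => x.2 &&& y.2 = 0) {x y : Fin N × ℕ}
    (hx : x ∈ chosen) (hy : y ∈ chosen) (hne : x ≠ y) : x.2 &&& y.2 = 0 := by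
  induction chosen with
  | nil => exact absurd hx List.not_mem_nil
  | cons z l ih =>
    rw [List.pairwise_cons] at hdisj
    rcases List.mem_cons.1 hx with rfl | hx'
    · rcases List.mem_cons.1 hy with rfl | hy'
      · exact absurd rfl hne
      · exact hdisj.1 y hy'
    · rcases List.mem_cons.1 hy with rfl | hy'
      · rw [Nat.land_comm]; exact hdisj.1 x hx'
      · exact ih hdisj.2 hx' hy'

/-- **Leaf step**: when every letter holds a diagonal and the diagonals are pairwise disjoint, the
only normalised consistent word is `wordOf chosen`, and it is consistent. [folklore] -/
private theorem partialSum_leaf (hb : 1 ≤ b) (chosen : List (Fin N × ℕ))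
    (hall : ∀ a : Fin N, a ∈ chosen.map Prod.fst)
    (hdl : ∀ ad ∈ chosen, ad.2 ∈ diagList e₁ e₂ e₃ ad.1)
    (hdisj : chosen.Pairwise fun x y => x.2 &&& y.2 = 0) :
    partialSum e₁ e₂ e₃ chosen = DesignEnum.tripleZ e₁ e₂ e₃ (wordOf e₁ chosen) := by
  classical
  -- coverage of every position off block 0
  have hcover : ∀ p : Fin D, (e₁ p).1 ≠ 0 → ∃ ad ∈ chosen, ad.2.testBit p.val = true := by
    intro p hp0
    set i := (e₁ p).1 with hi
    -- for each letter, its chosen mask and block-`i` index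
    have hex : ∀ a : Fin N, ∃ d, (a, d) ∈ chosen := by
      intro a
      obtain ⟨ad, had, h⟩ := List.mem_map.1 (hall a)
      exact ⟨ad.2, by rw [← h]; exact had⟩
    choose dOf hdOf using hex
    have hj : ∀ a : Fin N, ∃ j : Fin N, (dOf a).testBit (pos e₁ i j).val = true := fun a =>
      testBit_pos_of_mem_diagList e₁ e₂ e₃ a (hdl _ (hdOf a)) i hp0
    choose jOf hjOf using hj
    have hinj : Function.Injective jOf := by
      intro a a' h
      by_contra hne
      have hne' : (a, dOf a) ≠ (a', dOf a') := fun h' => hne (Prod.mk.inj h').1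
      have h0 := land_eq_zero_of_mem hdisj (hdOf a) (hdOf a') hne'
      exact (land_eq_zero_iff _ _).1 h0 _ ⟨hjOf a, h ▸ hjOf a'⟩
    obtain ⟨a, ha⟩ := (Finite.injective_iff_surjective.1 hinj) (e₁ p).2
    refine ⟨(a, dOf a), hdOf a, ?_⟩
    have hp : p = pos e₁ i (jOf a) := by
      rw [ha, hi, pos]; simp
    rw [hp]; exact hjOf a
  -- `wordOf chosen` is normalised and consistent
  have hnormW : IsNormalised e₁ (wordOf e₁ chosen) := by
    intro j; simp [wordOf]
  have hconsW : Cons chosen (wordOf e₁ chosen) := by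
    intro ad had p hp
    by_cases h0 : (e₁ p).1 = 0
    · have := eq_start_of_testBit e₁ e₂ e₃ ad.1 (hdl ad had) hb hp h0
      rw [this, wordOf]; simp
    · rw [wordOf, if_neg h0]
      cases hf : chosen.find? (fun ad => ad.2.testBit p.val) with
      | none =>
        exfalso
        rw [List.find?_eq_none] at hf
        exact hf ad had hp
      | some ad' =>
        simp only
        have had' : ad' ∈ chosen := List.mem_of_find?_eq_some hf
        have hp' : ad'.2.testBit p.val = true := by
          have := List.find?_some hf; simpa using this
        by_contra hne
        have hne' : ad' ≠ ad := fun h => hne (by rw [h])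
        have h0' := land_eq_zero_of_mem hdisj had' had hne'
        exact (land_eq_zero_iff _ _).1 h0' _ ⟨hp', hp⟩
  -- and it is the only normalised consistent word
  have huniq : ∀ u, IsNormalised e₁ u → Cons chosen u → u = wordOf e₁ chosen := by
    intro u hn hc
    funext p
    by_cases h0 : (e₁ p).1 = 0
    · have hp : p = e₁.symm (0, (e₁ p).2) := by
        rw [← h0]; simp
      rw [hp, hn, hnormW]
    · obtain ⟨ad, had, hbit⟩ := hcover p h0
      rw [hc ad had p hbit, hconsW ad had p hbit]
  unfold partialSum
  rw [Finset.sum_eq_single (wordOf e₁ chosen)]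
  · rw [if_pos ⟨hnormW, hconsW⟩]
  · intro u _ hu
    rw [if_neg]
    rintro ⟨hn, hc⟩
    exact hu (huniq u hn hc)
  · intro h; exact absurd (Finset.mem_univ _) h

/-- **Soundness of stage 2** (the invariant induction): on a node whose chosen diagonals are listed,
pairwise disjoint, with occupancy mask `occ`, and whose remaining letters complete the alphabet
without repetition, `coverSum` returns the partial sum. [folklore] -/
private theorem coverSum_eq_partialSum (hb : 1 ≤ b) :
    ∀ (rest : List (Fin N)) (occ : ℕ) (chosen : List (Fin N × ℕ)),
      (rest ++ chosen.map Prod.fst).Nodup →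
      (∀ a : Fin N, a ∈ rest ++ chosen.map Prod.fst) →
      (∀ n, occ.testBit n = true ↔ ∃ ad ∈ chosen, ad.2.testBit n = true) →
      (∀ ad ∈ chosen, ad.2 ∈ diagList e₁ e₂ e₃ ad.1) →
      chosen.Pairwise (fun x y => x.2 &&& y.2 = 0) →
      coverSum e₁ e₂ e₃ (diagList e₁ e₂ e₃) rest occ chosen = partialSum e₁ e₂ e₃ chosen := by
  intro rest
  induction rest with
  | nil =>
    intro occ chosen hnd hall hocc hdl hdisj
    rw [coverSum, partialSum_leaf e₁ e₂ e₃ hb chosen (fun a => by simpa using hall a) hdl hdisj]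
  | cons a rest ih =>
    intro occ chosen hnd hall hocc hdl hdisj
    rw [coverSum, partialSum_split e₁ e₂ e₃ hb chosen a]
    congr 1
    refine List.map_congr_left fun d hd => ?_
    have ha : a ∉ chosen.map Prod.fst := by
      intro h
      rw [List.cons_append, List.nodup_cons] at hnd
      exact hnd.1 (List.mem_append_right _ h)
    by_cases hland : occ &&& d = 0
    · rw [if_pos hland]
      refine ih (occ ||| d) ((a, d) :: chosen) ?_ ?_ ?_ ?_ ?_
      · have : (rest ++ ((a, d) :: chosen).map Prod.fst).Perm (a :: rest ++ chosen.map Prod.fst) := by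
          simp only [List.map_cons, List.cons_append]
          exact List.perm_middle
        exact this.nodup_iff.2 hnd
      · intro a'
        have := hall a'
        simp only [List.cons_append, List.mem_cons, List.mem_append, List.map_cons, List.mem_map] at this ⊢
        tauto
      · intro n
        rw [Nat.testBit_lor, Bool.or_eq_true, hocc]
        simp only [List.mem_cons, exists_eq_or_imp]
        exact or_comm
      · intro ad had
        rcases List.mem_cons.1 had with rfl | had
        · exact hd
        · exact hdl ad had
      · rw [List.pairwise_cons]
        refine ⟨fun ad had => ?_, hdisj⟩
        rw [land_eq_zero_iff]
        rintro n ⟨hdn, hadn⟩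
        exact (land_eq_zero_iff _ _).1 hland n ⟨(hocc n).2 ⟨ad, had, hadn⟩, hdn⟩
    · rw [if_neg hland]
      symm
      obtain ⟨n, hn⟩ : ∃ n, occ.testBit n = true ∧ d.testBit n = true := by
        have h' : ¬ ∀ n, ¬ (occ.testBit n = true ∧ d.testBit n = true) :=
          fun h => hland ((land_eq_zero_iff _ _).2 h)
        obtain ⟨n, hn⟩ := not_forall.1 h'
        exact ⟨n, not_not.1 hn⟩
      exact partialSum_cons_eq_zero e₁ e₂ e₃ chosen a d ha hd hn.2 ((hocc n).1 hn.1)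

/-- **The letter-major evaluator computes the normalised signed count**, for any service order
`ord` listing every letter once. [cite: AmanovYeliussizov2022, Thm. 8.4 (ii)] -/
theorem lmEval_eq_normSum (hb : 1 ≤ b) (ord : List (Fin N)) (hnd : ord.Nodup) (hall : ∀ a, a ∈ ord) :
    lmEval e₁ e₂ e₃ ord = normSum e₁ e₂ e₃ := by
  rw [lmEval, ← partialSum_nil e₁ e₂ e₃]
  refine coverSum_eq_partialSum e₁ e₂ e₃ hb ord 0 [] (by simpa using hnd) (by simpa using hall)
    (fun n => ?_) (fun ad h => absurd h List.not_mem_nil) List.Pairwise.nil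
  simp

end Sound

/-! ### §5 The certificate interface -/

section Certificate

variable {m δ : ℕ} [NeZero δ]

/-- `coverSum` only depends on the diagonal lists up to reordering (plumbing, so that certificate
files may carry the stage-1 lists as precomputed literal tables checked by `List.Perm`). [folklore] -/
private theorem coverSum_congr_perm (e₁ e₂ e₃ : Fin (m * δ) ≃ Fin δ × Fin m) (dl dl' : Fin m → List ℕ)
    (hperm : ∀ a, (dl a).Perm (dl' a)) :
    ∀ (rest : List (Fin m)) (occ : ℕ) (chosen : List (Fin m × ℕ)),
      coverSum e₁ e₂ e₃ dl rest occ chosen = coverSum e₁ e₂ e₃ dl' rest occ chosen := by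
  intro rest
  induction rest with
  | nil => intro occ chosen; rfl
  | cons a rest ih =>
    intro occ chosen
    rw [coverSum, coverSum]
    have hf : (fun d => if occ &&& d = 0 then coverSum e₁ e₂ e₃ dl rest (occ ||| d) ((a, d) :: chosen) else 0) =
        (fun d => if occ &&& d = 0 then coverSum e₁ e₂ e₃ dl' rest (occ ||| d) ((a, d) :: chosen) else 0) := by
      funext d
      split_ifs
      · exact ih _ _
      · rfl
    rw [hf]
    exact ((hperm a).map _).sum_eq

/-- **Letter-major design certificate ⇒ `k_m(δ) > 0`** (even `δ ≥ 1`): three block structures on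
`m·δ` positions, a service order listing the `m` letters once each, and a nonzero value of the
letter-major evaluator `lmEval` give `0 < kronRect k m δ`.
[cite: BurgisserIkenmeyer2017, Thm. 5.9 (proof of (2))] [cite: AmanovYeliussizov2022, Thm. 8.4 and Cor. 8.5] -/
theorem kronRect_pos_of_lmEval_ne_zero (k : Type*) [Field k] [CharZero k]
    (hδ : Even δ) (e₁ e₂ e₃ : Fin (m * δ) ≃ Fin δ × Fin m) (ord : List (Fin m))
    (hnd : ord.Nodup) (hall : ∀ a, a ∈ ord) (h : lmEval e₁ e₂ e₃ ord ≠ 0) :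
    0 < kronRect k m δ := by
  refine kronRect_pos_of_normSum_ne_zero k hδ e₁ e₂ e₃ ?_
  rw [← lmEval_eq_normSum e₁ e₂ e₃ (Nat.one_le_iff_ne_zero.2 (NeZero.ne δ)) ord hnd hall]
  exact h

/-- **Letter-major design certificate with precomputed diagonal tables ⇒ `k_m(δ) > 0`** (even
`δ ≥ 1`): as `kronRect_pos_of_lmEval_ne_zero`, with the stage-1 lists supplied as a table `dl`
that is a letter-wise permutation of `diagList` (checked by `decide` in the certificate file) and
the stage-2 value `coverSum … dl ord 0 [] ≠ 0` (a kernel computation).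
[cite: BurgisserIkenmeyer2017, Thm. 5.9 (proof of (2))] [cite: AmanovYeliussizov2022, Thm. 8.4 and Cor. 8.5] -/
theorem kronRect_pos_of_coverSum_ne_zero (k : Type*) [Field k] [CharZero k]
    (hδ : Even δ) (e₁ e₂ e₃ : Fin (m * δ) ≃ Fin δ × Fin m) (dl : Fin m → List ℕ)
    (hperm : ∀ a, (dl a).Perm (diagList e₁ e₂ e₃ a)) (ord : List (Fin m))
    (hnd : ord.Nodup) (hall : ∀ a, a ∈ ord) (h : coverSum e₁ e₂ e₃ dl ord 0 [] ≠ 0) :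
    0 < kronRect k m δ := by
  refine kronRect_pos_of_lmEval_ne_zero k hδ e₁ e₂ e₃ ord hnd hall ?_
  rw [lmEval, ← coverSum_congr_perm e₁ e₂ e₃ dl _ hperm]
  exact h

end Certificate

/-! #### A kernel smoke test: the cube `[2]^3` with `4` letters (`k_4(2) = 1`; `4!·1` Latin colourings) -/

section SmokeTest

/-- The cube `[2]^3`, positions `p = 4x + 2y + z`; `x`-slices. [folklore] -/
private def cubeX : Fin 8 ≃ Fin 2 × Fin 4 where
  toFun p := (⟨p.val / 4, by omega⟩, ⟨p.val % 4, by omega⟩)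
  invFun ij := ⟨4 * ij.1.val + ij.2.val, by omega⟩
  left_inv p := by ext; simp only; omega
  right_inv ij := by
    ext <;> simp only
    · omega
    · omega

/-- `y`-slices of `[2]^3`: block `y = (p/2)%2`, index `2x + z`. [folklore] -/
private def cubeY : Fin 8 ≃ Fin 2 × Fin 4 where
  toFun p := (⟨(p.val / 2) % 2, by omega⟩, ⟨2 * (p.val / 4) + p.val % 2, by omega⟩)
  invFun ij := ⟨4 * (ij.2.val / 2) + 2 * ij.1.val + ij.2.val % 2, by omega⟩
  left_inv p := by ext; simp only; omega
  right_inv ij := by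
    ext <;> simp only
    · omega
    · omega

/-- `z`-slices of `[2]^3`: block `z = p%2`, index `2x + y`. [folklore] -/
private def cubeZ : Fin 8 ≃ Fin 2 × Fin 4 where
  toFun p := (⟨p.val % 2, by omega⟩, ⟨2 * (p.val / 4) + (p.val / 2) % 2, by omega⟩)
  invFun ij := ⟨4 * (ij.2.val / 2) + 2 * (ij.2.val % 2) + ij.1.val, by omega⟩
  left_inv p := by ext; simp only; omega
  right_inv ij := by
    ext <;> simp only
    · omega
    · omega

example : lmEval cubeX cubeY cubeZ [0, 1, 2, 3] = 1 := by decide +kernel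

end SmokeTest

end DesignLM

end Literature.Computability.AlgebraicComplexity
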